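import Summits.BirchSwinnertonDyer.BirchSwinnertonDyer.Theorems.PrintCf2SplitBadTwoLevelProjTorsionClasses
import Summits.BirchSwinnertonDyer.BirchSwinnertonDyer.Theorems.PrintCf2SplitBadTwoIsotropicLevelSplitting
import Summits.BirchSwinnertonDyer.BirchSwinnertonDyer.Theorems.PrintCf2SplitBadTwoF3OfLevelCounts
import Summits.BirchSwinnertonDyer.BirchSwinnertonDyer.Theorems.SchneiderFreeAdditiveX3PoitouTateSelmerDualityHolds
import Summits.BirchSwinnertonDyer.BirchSwinnertonDyer.Theorems.PrintCf2SplitBadTwoLF1Holds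
import HarnessLib

/-!
# Crux `PrintCf2.SplitBadTwoRankOneOfFacts` (stmt-BirchSwinnertonDyer-20368), road α v10.3, S3c input (F3):
# ASSEMBLY `hcounts ⟸ (LF.1) ∧ (T4)` — the level-`N` index count from the local torsion count at `v` and the dual image count

Cell `bsd-print-cf2`, EXTRA WIDTH seat `bsd-line-cf2-p1-w4` g10 (prover-bsd-line-cf2-p1-w4-g10-0); `--supports stmt-BirchSwinnertonDyer-20368`
(helper, Theses-free). HONEST FRAMING: nothing here closes the crux or a registered stub; BSD is not proved by any of this; no summit
statement is proved by this seat. No definition, no named fact, no `sorry`.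

WHAT ((ASM) of -w2 g11's decomposition, STATUS 2026-08-28T23:38:20Z). **`hcounts_of_localTorsionCount_of_dualImageCount (hLF1) (hT4) :
<the displayed hypothesis `hcounts` of -w5 g3 p678471 `hF3_of_levelCounts` VERBATIM>`** — so that
`restrictedControl_two_of_ptFacts_F1_F3_H2 hPT hPTs hcd hF1 (hF3_of_levelCounts (hcounts_of_localTorsionCount_of_dualImageCount hLF1 hT4)) hH2 : S3c`
(cut 14 p677854; elaboration checked) — from two displayed hypotheses, each a closed statement over the S3c frame binders of `hcounts`:
* **(LF.1)** (binders `d hd0 hsq hd4 W C hC K hK v vbar hv hvbar hne`): `∃ N₂, ∀ N ≥ N₂, #E(K_v)[2^N] = 2^{t(d % 2, (d/(2 − d % 2)) % 8)}` — the local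
  `2`-primary torsion `Nat.card (nsmulAddMonoidHom (2^N) : ((W.baseChange K).baseChange (v.adicCompletion K)).toAffine.Point →+ _).ker` at the
  relaxed split place (-w2 g11, expected `t = 2 + [d ≡ 3 (8)]`);
* **(T4)** (all binders of `hcounts` incl. the CM projector `e`): `∃ N₃, ∀ N ≥ N₃`, for EVERY level splitting `ẽ_N + ẽ′_N = 1` shadowing `e` (values
  of `ẽ′_N` in `W*′`, both idempotent, both isotropic for every alternating Weil datum — the output of p677924
  `LevelEigen.exists_isotropic_levelSplitting_of_frame`), EVERY Poitou–Tate family `inv : LocalInvariants K (2^N)` (`IsPerfect`, `SumLocalTermEqZero`,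
  `UnramifiedOrthogonal`, `SelmerComplement`) and EVERY Option-A‴ structure `𝓕` (`⊤` at `∞`, torsion classes `N^E_w` off `v`, `(N^E_v).comap H¹(ẽ_N|K_v)`
  at `v`): `v₂ #((inv.dualSelmerStructure _ 𝓕).selmerGroup.map (localization (tateDual (2^N)) (inr v) 1)) = N − ℓ + e₄(d % 2, (d/(2 − d % 2)) % 8)`
  — the dual image count (-w8 g3 / -w3 g10 / -w2 g11; expected `e₄ = 1 + [d ≡ 3 (8)]`);
with `e₃ := t − e₄ − 1` (≡ 0 expected); and `hcounts_of_dualImageCount (hT4)` with (LF.1) := -w2 g11's `LocalLineCount.hLF1_holds` (p680264). PROOF: `e′` from `exists_eigenProjector_two` at `1 − r` and `e + e′ = 1` from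
`CMPrimes.endEigenPrimaryTorsion_two_structure`; at level `N ≥ max N₂ N₃ 1`: a Weil datum (`exists_weilPairing_holds`), the splitting `ẽ_N, ẽ′_N` (p677924),
isotropy for every Weil datum (p669287 `exists_forall_levelProj_eq_zsmul` + `weilPairingHom_apply_apply_eq_zero_of_cyclic`), the Poitou–Tate family
(tree theorem `SchneiderFreeAdditiveX3.PoitouTateReduction.poitouTate_selmerStructure_duality_holds`), `T ⊇ ∞ ∪ {w ∣ 2} ∪ bad`
(`KummerPT.exists_exceptional_finset`); then -w4 g9's master identity p678152 `relIndex_selmerGroup_update_top_mul_eq_of_levelProj` reads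
`[𝓖 : 𝓕] · L · 2 = 2^t · 2^N` by (LF.2) `natCard_ker_inf_range_map_levelProj_eq_two_of_frame` and (LF.3) `natCard_quot_adicCompletionIntegers_two_pow_of_split`
(this seat's `PrintCf2SplitBadTwoLevelProjTorsionClasses`), and `v₂ [𝓖 : 𝓕] = t + N − 1 − v₂ L = ℓ + (t − e₄ − 1)`.
presearch: Milne ADT I Thm. 4.10 / Howard Thm. 2.1.11 / Greenberg LNM 1716 §5 → tree theorems; no new fact. beyond-print theorem: no.

References: [MilneADT2006] I Lemma 3.3, Cor. 2.3, Thm. 2.8, Thm. 4.10; [Howard2004HeegnerKolyvagin] Thm. 2.1.11; [GreenbergLNM1716] §5 proof of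
Prop. 5.8; [Rubin1999] §2; [Agboola2007] §3, §6.
-/

noncomputable section

open scoped Classical

set_option linter.dupNamespace false
set_option autoImplicit false

open Function Field NumberField IsDedekindDomain WeierstrassCurve
open Literature.NumberTheory.EllipticCurves Literature.NumberTheory.EllipticCurves.GreenbergSelmer
open Literature.NumberTheory.EllipticCurves.Agboola2007
open Literature.NumberTheory.GaloisRepresentations
open Literature.NumberTheory.GaloisRepresentations.DiscreteGaloisModule (localTatePairingZMod tateDual SelmerStructure mu)
open Literature.NumberTheory.GaloisCohomology
open Literature.NumberTheory.GaloisCohomology.LocalInvariants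
open scoped ContRepresentation
open Summit.BirchSwinnertonDyer.Rank1Residual.X11b
open Summit.BirchSwinnertonDyer.Rank1Residual.X11b.Levels

namespace Summit.BirchSwinnertonDyer.BirchSwinnertonDyer.Theorems.PrintCf2.RestrictedSelmerPair

/-! ## (ASM): `hcounts ⟸ (LF.1) ∧ (T4)` -/

section Assembly

open Summit.BirchSwinnertonDyer.BirchSwinnertonDyer.Theorems.PrintCf2.AdditiveAtSeven
open Summit.BirchSwinnertonDyer.BirchSwinnertonDyer.Theorems.GoldfeldGoodTwists
open Summit.BirchSwinnertonDyer.BirchSwinnertonDyer.Theorems.SchneiderFreeAdditiveX3.PoitouTateReduction (poitouTate_selmerStructure_duality_holds)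

/-- **(ASM) `hcounts ⟸ (LF.1) ∧ (T4)`.** The displayed hypothesis `hcounts` of -w5 g3 p678471 `hF3_of_levelCounts` (hence `hF3` of cut 14, hence — with
(F1), (H2) and the three Poitou–Tate / cd facts — S3c `stub_restrictedControl_two`) VERBATIM, from two displayed hypotheses:
* **(LF.1)** «on every frame, for `N ≥ N₂`, `#E(K_v)[2^N] = 2^{t(class)}`» (the local `2`-primary torsion at the relaxed split place `v`; -w2 g11
  `…LocalTorsionCountAtV`, `t = 2 + [d ≡ 3 (8)]`), and
* **(T4)** «on every frame, for every CM projector `e`, `N ≥ N₃`, EVERY level splitting `ẽ_N + ẽ′_N = 1` shadowing `e` (values in `W*`, `W*′`, idempotent,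
  isotropic for every Weil datum — p677924), EVERY Poitou–Tate family `inv` at level `2^N` (perfect, (PT), Milne I 2.6, Howard 2.1.11) and EVERY Option-A‴
  structure `𝓕` (`⊤` at `∞`, torsion classes off `v`, `(N^E_v).comap H¹(ẽ_N)` at `v`):
  `v₂ #loc_v(H¹_{𝓕*}(K, E[2^N]^D)) = N − ℓ + e₄(class)`» (the dual image count; -w8 g3 / -w3 g10 / -w2 g11),
with `e₃ := t − e₄ − 1`. PROOF: choose `ẽ_N` by p677924 `exists_isotropic_levelSplitting_of_frame` (Weil datum from `exists_weilPairing_holds`, `e′` from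
`exists_eigenProjector_two` at `1 − r`), the Poitou–Tate family from the tree theorem `poitouTate_selmerStructure_duality_holds`, `T ⊇ ∞ ∪ {w ∣ 2} ∪ bad`
(`KummerPT.exists_exceptional_finset`); then -w4 g9's master identity p678152 `relIndex_selmerGroup_update_top_mul_eq_of_levelProj` reads
`[𝓖 : 𝓕] · L · 2 = 2^t · 2^N` by (LF.2) and (LF.3) of `PrintCf2SplitBadTwoLevelProjTorsionClasses`, and `v₂` gives `v₂ [𝓖 : 𝓕] = t + N − 1 − v₂ L = ℓ + (t − e₄ − 1)`.
[cite: MilneADT2006, I Lemma 3.3, Thm. 2.8, Cor. 2.3, Thm. 4.10] [cite: Howard2004HeegnerKolyvagin, Thm. 2.1.11 (arXiv:1202.6340 p. 6)]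
[cite: GreenbergLNM1716, §5 proof of Prop. 5.8] [cite: Rubin1999, §2] -/
theorem hcounts_of_localTorsionCount_of_dualImageCount
    (hLF1 : ∃ t : ℤ → ℤ → ℕ, ∀ (d : ℤ), d ≠ 0 → Squarefree d → d % 4 ≠ 1 →
      ∀ (W : WeierstrassCurve ℚ) [W.IsElliptic] [W.IsGloballyMinimal] (C : WeierstrassCurve.VariableChange ℚ),
        C • W = cm7.quadraticTwist (d : ℚ) →
      ∀ (K : Type) [Field K] [NumberField K], IsImaginaryQuadratic K →
      ∀ (v vbar : HeightOneSpectrum (𝓞 K)),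
        ((2 : ℕ) : 𝓞 K) ∈ v.asIdeal → ((2 : ℕ) : 𝓞 K) ∈ vbar.asIdeal → vbar ≠ v →
      ∃ N₂ : ℕ, ∀ N : ℕ, N₂ ≤ N →
        Nat.card (nsmulAddMonoidHom (2 ^ N) : ((W.baseChange K).baseChange (v.adicCompletion K)).toAffine.Point →+ _).ker =
          2 ^ t (d % 2) ((d / (2 - d % 2)) % 8))
    (hT4 : ∃ e₄ : ℤ → ℤ → ℤ, ∀ (d : ℤ), d ≠ 0 → Squarefree d → d % 4 ≠ 1 →
      ∀ (W : WeierstrassCurve ℚ) [W.IsElliptic] [W.IsGloballyMinimal] (C : WeierstrassCurve.VariableChange ℚ),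
        C • W = cm7.quadraticTwist (d : ℚ) → W.analyticRank = 1 →
      ∀ (K : Type) [Field K] [NumberField K], IsImaginaryQuadratic K →
      ∀ (v vbar : HeightOneSpectrum (𝓞 K)),
        ((2 : ℕ) : 𝓞 K) ∈ v.asIdeal → ((2 : ℕ) : 𝓞 K) ∈ vbar.asIdeal → vbar ≠ v →
      ∀ (π : (W.baseChange K).endRing), (π : AddMonoid.End (W.baseChange K).geomPoints) * π = π - 2 →
      ∀ (r : ℤ_[2]), r * r = r - 2 →
        (∀ τ ∈ GreenbergSelmer.inertia v, ∀ x : ↥((W.baseChange K).endEigenPrimaryTorsion 2 π r), τ • x = x ∨ τ • x = -x) →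
      ∀ (P : W.toAffine.Point) (c₀ : ℕ) (ℓ : ℤ),
        ¬ IsOfFinAddOrder P →
        (∀ R : W.toAffine.Point, ∃ (k : ℤ) (T : W.toAffine.Point), IsOfFinAddOrder T ∧ R = k • P + T) →
        c₀ ≠ 0 → (W.baseChange ℚ_[2]).IsInReductionKernel (c₀ • W.toPadicPoint 2 P) →
        ‖(W.baseChange ℚ_[2]).padicLogPoint (c₀ • W.toPadicPoint 2 P) / (c₀ : ℚ_[2])‖ = (2 : ℝ) ^ (-ℓ) →
      Finite (restrictedSelmerBase ↥((W.baseChange K).endEigenPrimaryTorsion 2 π r) 2 vbar) →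
      ∀ (e : (W.baseChange K).geomPrimaryTorsion 2 →+ ↥((W.baseChange K).endEigenPrimaryTorsion 2 π r)),
        (∀ x : ↥((W.baseChange K).endEigenPrimaryTorsion 2 π r), e x = x) →
        (∀ x ∈ (W.baseChange K).endEigenPrimaryTorsion 2 π (1 - r), e x = 0) →
        (∀ (σ : absoluteGaloisGroup K) (x : (W.baseChange K).geomPrimaryTorsion 2), e (σ • x) = σ • e x) →
      ∃ N₃ : ℕ, ∀ N : ℕ, N₃ ≤ N → ∀ [Finite ((W.baseChange K).geomTorsion ((2 ^ N : ℕ) : ℤ))],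
        ∀ (eN eN' : ((W.baseChange K).torsionGaloisModule ((2 ^ N : ℕ) : ℤ)).toContRepresentation →ⁱL
            ((W.baseChange K).torsionGaloisModule ((2 ^ N : ℕ) : ℤ)).toContRepresentation),
          (∀ y, primaryInclusion (W.baseChange K) 2 N (eN y) =
            (e (primaryInclusion (W.baseChange K) 2 N y) : (W.baseChange K).geomPrimaryTorsion 2)) →
          (∀ y, eN y + eN' y = y) →
          (∀ y, primaryInclusion (W.baseChange K) 2 N (eN' y) ∈ (W.baseChange K).endEigenPrimaryTorsion 2 π (1 - r)) →
          (∀ y, eN (eN y) = eN y) → (∀ y, eN' (eN' y) = eN' y) →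
          (∀ (ε : (W.baseChange K).geomTorsion ((2 ^ N : ℕ) : ℤ) → (W.baseChange K).geomTorsion ((2 ^ N : ℕ) : ℤ) → AlgebraicClosure K)
              (hμ : ∀ S T, ε S T ^ (2 ^ N) = 1) (hadd₁ : ∀ S₁ S₂ T, ε (S₁ + S₂) T = ε S₁ T * ε S₂ T)
              (hadd₂ : ∀ S T₁ T₂, ε S (T₁ + T₂) = ε S T₁ * ε S T₂), (∀ T, ε T T = 1) →
            (∀ x y, weilPairingHom (W.baseChange K) (2 ^ N) ε hμ hadd₁ hadd₂ (eN x) (eN y) = 0) ∧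
            (∀ x y, weilPairingHom (W.baseChange K) (2 ^ N) ε hμ hadd₁ hadd₂ (eN' x) (eN' y) = 0)) →
        ∀ (inv : LocalInvariants K (2 ^ N)), inv.IsPerfect → inv.SumLocalTermEqZero → inv.UnramifiedOrthogonal → inv.SelmerComplement →
        ∀ 𝓕 : SelmerStructure ((W.baseChange K).torsionGaloisModule ((2 ^ N : ℕ) : ℤ)),
          (∀ w : InfinitePlace K, 𝓕 (Sum.inl w) = ⊤) →
          (∀ w : HeightOneSpectrum (𝓞 K), w ≠ v →
            𝓕 (Sum.inr w) = (galoisCohomology.map ((primaryInclusion (W.baseChange K) 2 N).restrictField (w.adicCompletion K)) 1).ker) →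
          𝓕 (Sum.inr v) = ((galoisCohomology.map ((primaryInclusion (W.baseChange K) 2 N).restrictField (v.adicCompletion K)) 1).ker).comap
            (galoisCohomology.map (eN.restrictField (v.adicCompletion K)) 1) →
          (padicValNat 2 (Nat.card ((inv.dualSelmerStructure ((W.baseChange K).torsionGaloisModule ((2 ^ N : ℕ) : ℤ)) 𝓕).selmerGroup.map
              (galoisCohomology.localization (((W.baseChange K).torsionGaloisModule ((2 ^ N : ℕ) : ℤ)).tateDual (2 ^ N))
                (Sum.inr v : Place K) 1))) : ℤ) =
            N - ℓ + e₄ (d % 2) ((d / (2 - d % 2)) % 8)) :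
    ∃ e₃ : ℤ → ℤ → ℤ, ∀ (d : ℤ), d ≠ 0 → Squarefree d → d % 4 ≠ 1 →
      ∀ (W : WeierstrassCurve ℚ) [W.IsElliptic] [W.IsGloballyMinimal] (C : WeierstrassCurve.VariableChange ℚ),
        C • W = cm7.quadraticTwist (d : ℚ) → W.analyticRank = 1 →
      ∀ (K : Type) [Field K] [NumberField K], IsImaginaryQuadratic K →
      ∀ (v vbar : HeightOneSpectrum (𝓞 K)),
        ((2 : ℕ) : 𝓞 K) ∈ v.asIdeal → ((2 : ℕ) : 𝓞 K) ∈ vbar.asIdeal → vbar ≠ v →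
      ∀ (π : (W.baseChange K).endRing), (π : AddMonoid.End (W.baseChange K).geomPoints) * π = π - 2 →
      ∀ (r : ℤ_[2]), r * r = r - 2 →
        (∀ τ ∈ GreenbergSelmer.inertia v, ∀ x : ↥((W.baseChange K).endEigenPrimaryTorsion 2 π r), τ • x = x ∨ τ • x = -x) →
      ∀ (P : W.toAffine.Point) (c₀ : ℕ) (ℓ : ℤ),
        ¬ IsOfFinAddOrder P →
        (∀ R : W.toAffine.Point, ∃ (k : ℤ) (T : W.toAffine.Point), IsOfFinAddOrder T ∧ R = k • P + T) →
        c₀ ≠ 0 → (W.baseChange ℚ_[2]).IsInReductionKernel (c₀ • W.toPadicPoint 2 P) →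
        ‖(W.baseChange ℚ_[2]).padicLogPoint (c₀ • W.toPadicPoint 2 P) / (c₀ : ℚ_[2])‖ = (2 : ℝ) ^ (-ℓ) →
      Finite (restrictedSelmerBase ↥((W.baseChange K).endEigenPrimaryTorsion 2 π r) 2 vbar) →
      ∀ (e : (W.baseChange K).geomPrimaryTorsion 2 →+ ↥((W.baseChange K).endEigenPrimaryTorsion 2 π r)),
        (∀ x : ↥((W.baseChange K).endEigenPrimaryTorsion 2 π r), e x = x) →
        (∀ x ∈ (W.baseChange K).endEigenPrimaryTorsion 2 π (1 - r), e x = 0) →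
        (∀ (σ : absoluteGaloisGroup K) (x : (W.baseChange K).geomPrimaryTorsion 2), e (σ • x) = σ • e x) →
      ∃ N₁ : ℕ, ∀ N : ℕ, N₁ ≤ N →
        ∃ eN : ((W.baseChange K).torsionGaloisModule ((2 ^ N : ℕ) : ℤ)).toContRepresentation →ⁱL
            ((W.baseChange K).torsionGaloisModule ((2 ^ N : ℕ) : ℤ)).toContRepresentation,
          (∀ y, primaryInclusion (W.baseChange K) 2 N (eN y) =
            (e (primaryInclusion (W.baseChange K) 2 N y) : (W.baseChange K).geomPrimaryTorsion 2)) ∧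
          ∀ 𝓕 : SelmerStructure ((W.baseChange K).torsionGaloisModule ((2 ^ N : ℕ) : ℤ)),
            (∀ w : InfinitePlace K, 𝓕 (Sum.inl w) = ⊤) →
            (∀ w : HeightOneSpectrum (𝓞 K), w ≠ v →
              𝓕 (Sum.inr w) = (galoisCohomology.map ((primaryInclusion (W.baseChange K) 2 N).restrictField (w.adicCompletion K)) 1).ker) →
            𝓕 (Sum.inr v) = ((galoisCohomology.map ((primaryInclusion (W.baseChange K) 2 N).restrictField (v.adicCompletion K)) 1).ker).comap
              (galoisCohomology.map (eN.restrictField (v.adicCompletion K)) 1) →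
            (padicValNat 2 (𝓕.selmerGroup.relIndex (SelmerStructure.selmerGroup (Function.update 𝓕 (Sum.inr v : Place K) ⊤))) : ℤ) =
              ℓ + e₃ (d % 2) ((d / (2 - d % 2)) % 8) := by
  obtain ⟨t, hLF1⟩ := hLF1
  obtain ⟨e₄, hT4⟩ := hT4
  refine ⟨fun a b ↦ (t a b : ℤ) - e₄ a b - 1, ?_⟩
  intro d hd0 hsq hd4 W _ _ C hC hrk K _ _ hK v vbar hv hvbar hne π hrel r hr hpin P c₀ ℓ hP hgen hc₀ hker hlog hfin e he₁ he0 he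
  haveI : Fact (Nat.Prime 2) := ⟨Nat.prime_two⟩
  haveI : (W.baseChange K).IsElliptic := by rw [baseChange]; infer_instance
  -- frame facts: `j`, `θ`, the complementary projector `e′`, `e + e′ = 1`
  have hj : W.j = -3375 := j_eq_of_smul_eq_cm7Twist hd0 W C hC
  obtain ⟨θ, hθ⟩ := exists_sq_eq_neg_seven_of_cmEndo_mem_endRing W K hj π hrel
  have hr' : (1 - r) * (1 - r) = (1 - r) - 2 := by linear_combination hr
  obtain ⟨e', he'₁, he'0, -, he'⟩ := exists_eigenProjector_two W hj K hθ π hrel hr'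
  have h11 : (1 : ℤ_[2]) - (1 - r) = r := sub_sub_cancel 1 r
  rw [h11] at he'0
  obtain ⟨-, hsup, -⟩ := CMPrimes.endEigenPrimaryTorsion_two_structure W hj K hθ π hrel hr
  have hsum : ∀ x, (e x : (W.baseChange K).geomPrimaryTorsion 2) + (e' x : (W.baseChange K).geomPrimaryTorsion 2) = x := by
    intro x
    have hx : x ∈ (W.baseChange K).endEigenPrimaryTorsion 2 π r ⊔ (W.baseChange K).endEigenPrimaryTorsion 2 π (1 - r) := by
      rw [hsup]; exact AddSubgroup.mem_top x
    obtain ⟨y, hy, z, hz, rfl⟩ := AddSubgroup.mem_sup.mp hx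
    have hey : (e y : (W.baseChange K).geomPrimaryTorsion 2) = y := congrArg Subtype.val (he₁ ⟨y, hy⟩)
    have hez : (e' z : (W.baseChange K).geomPrimaryTorsion 2) = z := congrArg Subtype.val (he'₁ ⟨z, hz⟩)
    rw [map_add, map_add, AddSubgroup.coe_add, AddSubgroup.coe_add, hey, hez, he0 z hz, he'0 y hy, ZeroMemClass.coe_zero, ZeroMemClass.coe_zero]
    abel
  -- thresholds
  obtain ⟨N₂, hN₂⟩ := hLF1 d hd0 hsq hd4 W C hC K hK v vbar hv hvbar hne
  obtain ⟨N₃, hN₃⟩ := hT4 d hd0 hsq hd4 W C hC hrk K hK v vbar hv hvbar hne π hrel r hr hpin P c₀ ℓ hP hgen hc₀ hker hlog hfin e he₁ he0 he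
  refine ⟨max (max N₂ N₃) 1, fun N hN ↦ ?_⟩
  have hN2 : N₂ ≤ N := le_trans (le_trans (le_max_left _ _) (le_max_left _ _)) hN
  have hN3 : N₃ ≤ N := le_trans (le_trans (le_max_right _ _) (le_max_left _ _)) hN
  have hN1 : 1 ≤ N := le_trans (le_max_right _ _) hN
  have hNpos : 0 < N := hN1
  haveI : NeZero ((2 ^ N : ℕ) : ℤ) := ⟨by exact_mod_cast pow_ne_zero N two_ne_zero⟩
  haveI : Finite ((W.baseChange K).geomTorsion ((2 ^ N : ℕ) : ℤ)) := finite_geomTorsion_of_neZero (W.baseChange K) (2 ^ N)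
  -- a Weil pairing datum at level `2^N`
  have hp2 : 2 ≤ 2 ^ N := by
    calc (2 : ℕ) = 2 ^ 1 := (pow_one 2).symm
      _ ≤ 2 ^ N := Nat.pow_le_pow_right two_pos hN1
  have hchar : ((2 ^ N : ℕ) : K) ≠ 0 := Nat.cast_ne_zero.mpr (pow_ne_zero N two_ne_zero)
  obtain ⟨ε, hμ, hadd₁, hadd₂, halt, hnondeg, hgal⟩ := (W.baseChange K).exists_weilPairing_holds (2 ^ N) hp2 hchar
  -- the isotropic level splitting `ẽ_N + ẽ′_N = 1`
  obtain ⟨eN, eN', hιe, -, hsumN, hval, hval', hidem, hidem', hiso, hiso'⟩ :=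
    LevelEigen.exists_isotropic_levelSplitting_of_frame W hj K hθ π hrel hr e e' he₁ he he'₁ he' hsum N ε hμ hadd₁ hadd₂ halt
  refine ⟨eN, hιe, fun 𝓕 h𝓕inf h𝓕 h𝓕v ↦ ?_⟩
  -- isotropy for EVERY Weil datum (both level pieces are cyclic)
  have hisoall : ∀ (ε₁ : (W.baseChange K).geomTorsion ((2 ^ N : ℕ) : ℤ) → (W.baseChange K).geomTorsion ((2 ^ N : ℕ) : ℤ) → AlgebraicClosure K)
      (hμ₁ : ∀ S T, ε₁ S T ^ (2 ^ N) = 1) (hadd₁₁ : ∀ S₁ S₂ T, ε₁ (S₁ + S₂) T = ε₁ S₁ T * ε₁ S₂ T)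
      (hadd₂₁ : ∀ S T₁ T₂, ε₁ S (T₁ + T₂) = ε₁ S T₁ * ε₁ S T₂), (∀ T, ε₁ T T = 1) →
      (∀ x y, weilPairingHom (W.baseChange K) (2 ^ N) ε₁ hμ₁ hadd₁₁ hadd₂₁ (eN x) (eN y) = 0) ∧
      (∀ x y, weilPairingHom (W.baseChange K) (2 ^ N) ε₁ hμ₁ hadd₁₁ hadd₂₁ (eN' x) (eN' y) = 0) := by
    intro ε₁ hμ₁ hadd₁₁ hadd₂₁ halt₁
    obtain ⟨g, hcyc⟩ := LevelEigen.exists_forall_levelProj_eq_zsmul W hj K hθ π hrel hr N eN hval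
    obtain ⟨g', hcyc'⟩ := LevelEigen.exists_forall_levelProj_eq_zsmul W hj K hθ π hrel hr' N eN' hval'
    exact ⟨LevelEigen.weilPairingHom_apply_apply_eq_zero_of_cyclic (W.baseChange K) (2 ^ N) ε₁ hμ₁ hadd₁₁ hadd₂₁ halt₁ eN hcyc,
      LevelEigen.weilPairingHom_apply_apply_eq_zero_of_cyclic (W.baseChange K) (2 ^ N) ε₁ hμ₁ hadd₁₁ hadd₂₁ halt₁ eN' hcyc'⟩
  -- the Poitou–Tate family and the exceptional set `T`
  obtain ⟨inv, hperf, hvan, hunr, hcomp⟩ := poitouTate_selmerStructure_duality_holds K (2 ^ N)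
  obtain ⟨T, -, hinf, hpT, hbad⟩ := KummerPT.exists_exceptional_finset (W.baseChange K) 2 (∅ : Finset (Place K))
  -- the master identity `R · L · C = #E(K_v)[2^N] · #(𝓞_v ⧸ 2^N)`
  have hM := relIndex_selmerGroup_update_top_mul_eq_of_levelProj (W.baseChange K) 2 N ε hμ hadd₁ hadd₂ hgal hnondeg hNpos hperf hvan hcomp
    T hinf hpT hbad v (hpT v hv) eN eN' hsumN hidem hiso hiso' 𝓕 h𝓕 h𝓕v
  -- the four values
  have hC2 := natCard_ker_inf_range_map_levelProj_eq_two_of_frame hd0 hsq hd4 W C hC hK v vbar hv hvbar hne π hrel hr hpin e he₁ he hNpos eN hιe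
  have hO := natCard_quot_adicCompletionIntegers_two_pow_of_split hK.1 hv hvbar hne N
  have hEt := hN₂ N hN2
  have hL := hN₃ N hN3 eN eN' hιe hsumN hval' hidem hidem' hisoall inv hperf hvan hunr hcomp 𝓕 h𝓕inf h𝓕 h𝓕v
  rw [hC2, hO, hEt] at hM
  -- `v₂`: `v₂ R + v₂ L + 1 = t + N`
  set R := 𝓕.selmerGroup.relIndex (SelmerStructure.selmerGroup (Function.update 𝓕 (Sum.inr v : Place K) ⊤)) with hR
  set L := Nat.card ((inv.dualSelmerStructure ((W.baseChange K).torsionGaloisModule ((2 ^ N : ℕ) : ℤ)) 𝓕).selmerGroup.map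
    (galoisCohomology.localization (((W.baseChange K).torsionGaloisModule ((2 ^ N : ℕ) : ℤ)).tateDual (2 ^ N)) (Sum.inr v : Place K) 1)) with hLdef
  have hprod : R * L * 2 = 2 ^ (t (d % 2) ((d / (2 - d % 2)) % 8) + N) := by rw [pow_add]; exact hM
  have hne0 : R * L * 2 ≠ 0 := by rw [hprod]; exact pow_ne_zero _ two_ne_zero
  have hR0 : R ≠ 0 := fun h ↦ hne0 (by rw [h, zero_mul, zero_mul])
  have hL0 : L ≠ 0 := fun h ↦ hne0 (by rw [h, mul_zero, zero_mul])
  have hval2 : padicValNat 2 R + padicValNat 2 L + 1 = t (d % 2) ((d / (2 - d % 2)) % 8) + N := by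
    have h := congrArg (padicValNat 2) hprod
    rwa [padicValNat.mul (mul_ne_zero hR0 hL0) two_ne_zero, padicValNat.mul hR0 hL0, padicValNat.prime_pow, padicValNat_self] at h
  have hval2' : ((padicValNat 2 R : ℕ) : ℤ) + (padicValNat 2 L : ℕ) + 1 = (t (d % 2) ((d / (2 - d % 2)) % 8) : ℤ) + N := by
    exact_mod_cast hval2
  change ((padicValNat 2 L : ℕ) : ℤ) = N - ℓ + e₄ (d % 2) ((d / (2 - d % 2)) % 8) at hL
  change ((padicValNat 2 R : ℕ) : ℤ) = ℓ + ((t (d % 2) ((d / (2 - d % 2)) % 8) : ℤ) - e₄ (d % 2) ((d / (2 - d % 2)) % 8) - 1)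
  omega

/-- **(ASM′) `hcounts ⟸ (T4)` alone**: (LF.1) is -w2 g11's tree theorem `LocalLineCount.hLF1_holds` (p680264, `t = 2 + [d ≡ 3 (8)]`), so on the Option-A‴ road
the displayed hypothesis `hcounts` of p678471 / p679366 hangs on the dual image count (T4) ALONE (`e₃ = t − e₄ − 1`).
[cite: MilneADT2006, I Thm. 4.10] [cite: Howard2004HeegnerKolyvagin, Thm. 2.1.11 (arXiv:1202.6340 p. 6)] [cite: GreenbergLNM1716, §5 proof of Prop. 5.8] -/
theorem hcounts_of_dualImageCount
    (hT4 : ∃ e₄ : ℤ → ℤ → ℤ, ∀ (d : ℤ), d ≠ 0 → Squarefree d → d % 4 ≠ 1 →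
      ∀ (W : WeierstrassCurve ℚ) [W.IsElliptic] [W.IsGloballyMinimal] (C : WeierstrassCurve.VariableChange ℚ),
        C • W = cm7.quadraticTwist (d : ℚ) → W.analyticRank = 1 →
      ∀ (K : Type) [Field K] [NumberField K], IsImaginaryQuadratic K →
      ∀ (v vbar : HeightOneSpectrum (𝓞 K)),
        ((2 : ℕ) : 𝓞 K) ∈ v.asIdeal → ((2 : ℕ) : 𝓞 K) ∈ vbar.asIdeal → vbar ≠ v →
      ∀ (π : (W.baseChange K).endRing), (π : AddMonoid.End (W.baseChange K).geomPoints) * π = π - 2 →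
      ∀ (r : ℤ_[2]), r * r = r - 2 →
        (∀ τ ∈ GreenbergSelmer.inertia v, ∀ x : ↥((W.baseChange K).endEigenPrimaryTorsion 2 π r), τ • x = x ∨ τ • x = -x) →
      ∀ (P : W.toAffine.Point) (c₀ : ℕ) (ℓ : ℤ),
        ¬ IsOfFinAddOrder P →
        (∀ R : W.toAffine.Point, ∃ (k : ℤ) (T : W.toAffine.Point), IsOfFinAddOrder T ∧ R = k • P + T) →
        c₀ ≠ 0 → (W.baseChange ℚ_[2]).IsInReductionKernel (c₀ • W.toPadicPoint 2 P) →
        ‖(W.baseChange ℚ_[2]).padicLogPoint (c₀ • W.toPadicPoint 2 P) / (c₀ : ℚ_[2])‖ = (2 : ℝ) ^ (-ℓ) →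
      Finite (restrictedSelmerBase ↥((W.baseChange K).endEigenPrimaryTorsion 2 π r) 2 vbar) →
      ∀ (e : (W.baseChange K).geomPrimaryTorsion 2 →+ ↥((W.baseChange K).endEigenPrimaryTorsion 2 π r)),
        (∀ x : ↥((W.baseChange K).endEigenPrimaryTorsion 2 π r), e x = x) →
        (∀ x ∈ (W.baseChange K).endEigenPrimaryTorsion 2 π (1 - r), e x = 0) →
        (∀ (σ : absoluteGaloisGroup K) (x : (W.baseChange K).geomPrimaryTorsion 2), e (σ • x) = σ • e x) →
      ∃ N₃ : ℕ, ∀ N : ℕ, N₃ ≤ N → ∀ [Finite ((W.baseChange K).geomTorsion ((2 ^ N : ℕ) : ℤ))],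
        ∀ (eN eN' : ((W.baseChange K).torsionGaloisModule ((2 ^ N : ℕ) : ℤ)).toContRepresentation →ⁱL
            ((W.baseChange K).torsionGaloisModule ((2 ^ N : ℕ) : ℤ)).toContRepresentation),
          (∀ y, primaryInclusion (W.baseChange K) 2 N (eN y) =
            (e (primaryInclusion (W.baseChange K) 2 N y) : (W.baseChange K).geomPrimaryTorsion 2)) →
          (∀ y, eN y + eN' y = y) →
          (∀ y, primaryInclusion (W.baseChange K) 2 N (eN' y) ∈ (W.baseChange K).endEigenPrimaryTorsion 2 π (1 - r)) →
          (∀ y, eN (eN y) = eN y) → (∀ y, eN' (eN' y) = eN' y) →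
          (∀ (ε : (W.baseChange K).geomTorsion ((2 ^ N : ℕ) : ℤ) → (W.baseChange K).geomTorsion ((2 ^ N : ℕ) : ℤ) → AlgebraicClosure K)
              (hμ : ∀ S T, ε S T ^ (2 ^ N) = 1) (hadd₁ : ∀ S₁ S₂ T, ε (S₁ + S₂) T = ε S₁ T * ε S₂ T)
              (hadd₂ : ∀ S T₁ T₂, ε S (T₁ + T₂) = ε S T₁ * ε S T₂), (∀ T, ε T T = 1) →
            (∀ x y, weilPairingHom (W.baseChange K) (2 ^ N) ε hμ hadd₁ hadd₂ (eN x) (eN y) = 0) ∧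
            (∀ x y, weilPairingHom (W.baseChange K) (2 ^ N) ε hμ hadd₁ hadd₂ (eN' x) (eN' y) = 0)) →
        ∀ (inv : LocalInvariants K (2 ^ N)), inv.IsPerfect → inv.SumLocalTermEqZero → inv.UnramifiedOrthogonal → inv.SelmerComplement →
        ∀ 𝓕 : SelmerStructure ((W.baseChange K).torsionGaloisModule ((2 ^ N : ℕ) : ℤ)),
          (∀ w : InfinitePlace K, 𝓕 (Sum.inl w) = ⊤) →
          (∀ w : HeightOneSpectrum (𝓞 K), w ≠ v →
            𝓕 (Sum.inr w) = (galoisCohomology.map ((primaryInclusion (W.baseChange K) 2 N).restrictField (w.adicCompletion K)) 1).ker) →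
          𝓕 (Sum.inr v) = ((galoisCohomology.map ((primaryInclusion (W.baseChange K) 2 N).restrictField (v.adicCompletion K)) 1).ker).comap
            (galoisCohomology.map (eN.restrictField (v.adicCompletion K)) 1) →
          (padicValNat 2 (Nat.card ((inv.dualSelmerStructure ((W.baseChange K).torsionGaloisModule ((2 ^ N : ℕ) : ℤ)) 𝓕).selmerGroup.map
              (galoisCohomology.localization (((W.baseChange K).torsionGaloisModule ((2 ^ N : ℕ) : ℤ)).tateDual (2 ^ N))
                (Sum.inr v : Place K) 1))) : ℤ) =
            N - ℓ + e₄ (d % 2) ((d / (2 - d % 2)) % 8)) :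
    ∃ e₃ : ℤ → ℤ → ℤ, ∀ (d : ℤ), d ≠ 0 → Squarefree d → d % 4 ≠ 1 →
      ∀ (W : WeierstrassCurve ℚ) [W.IsElliptic] [W.IsGloballyMinimal] (C : WeierstrassCurve.VariableChange ℚ),
        C • W = cm7.quadraticTwist (d : ℚ) → W.analyticRank = 1 →
      ∀ (K : Type) [Field K] [NumberField K], IsImaginaryQuadratic K →
      ∀ (v vbar : HeightOneSpectrum (𝓞 K)),
        ((2 : ℕ) : 𝓞 K) ∈ v.asIdeal → ((2 : ℕ) : 𝓞 K) ∈ vbar.asIdeal → vbar ≠ v →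
      ∀ (π : (W.baseChange K).endRing), (π : AddMonoid.End (W.baseChange K).geomPoints) * π = π - 2 →
      ∀ (r : ℤ_[2]), r * r = r - 2 →
        (∀ τ ∈ GreenbergSelmer.inertia v, ∀ x : ↥((W.baseChange K).endEigenPrimaryTorsion 2 π r), τ • x = x ∨ τ • x = -x) →
      ∀ (P : W.toAffine.Point) (c₀ : ℕ) (ℓ : ℤ),
        ¬ IsOfFinAddOrder P →
        (∀ R : W.toAffine.Point, ∃ (k : ℤ) (T : W.toAffine.Point), IsOfFinAddOrder T ∧ R = k • P + T) →
        c₀ ≠ 0 → (W.baseChange ℚ_[2]).IsInReductionKernel (c₀ • W.toPadicPoint 2 P) →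
        ‖(W.baseChange ℚ_[2]).padicLogPoint (c₀ • W.toPadicPoint 2 P) / (c₀ : ℚ_[2])‖ = (2 : ℝ) ^ (-ℓ) →
      Finite (restrictedSelmerBase ↥((W.baseChange K).endEigenPrimaryTorsion 2 π r) 2 vbar) →
      ∀ (e : (W.baseChange K).geomPrimaryTorsion 2 →+ ↥((W.baseChange K).endEigenPrimaryTorsion 2 π r)),
        (∀ x : ↥((W.baseChange K).endEigenPrimaryTorsion 2 π r), e x = x) →
        (∀ x ∈ (W.baseChange K).endEigenPrimaryTorsion 2 π (1 - r), e x = 0) →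
        (∀ (σ : absoluteGaloisGroup K) (x : (W.baseChange K).geomPrimaryTorsion 2), e (σ • x) = σ • e x) →
      ∃ N₁ : ℕ, ∀ N : ℕ, N₁ ≤ N →
        ∃ eN : ((W.baseChange K).torsionGaloisModule ((2 ^ N : ℕ) : ℤ)).toContRepresentation →ⁱL
            ((W.baseChange K).torsionGaloisModule ((2 ^ N : ℕ) : ℤ)).toContRepresentation,
          (∀ y, primaryInclusion (W.baseChange K) 2 N (eN y) =
            (e (primaryInclusion (W.baseChange K) 2 N y) : (W.baseChange K).geomPrimaryTorsion 2)) ∧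
          ∀ 𝓕 : SelmerStructure ((W.baseChange K).torsionGaloisModule ((2 ^ N : ℕ) : ℤ)),
            (∀ w : InfinitePlace K, 𝓕 (Sum.inl w) = ⊤) →
            (∀ w : HeightOneSpectrum (𝓞 K), w ≠ v →
              𝓕 (Sum.inr w) = (galoisCohomology.map ((primaryInclusion (W.baseChange K) 2 N).restrictField (w.adicCompletion K)) 1).ker) →
            𝓕 (Sum.inr v) = ((galoisCohomology.map ((primaryInclusion (W.baseChange K) 2 N).restrictField (v.adicCompletion K)) 1).ker).comap
              (galoisCohomology.map (eN.restrictField (v.adicCompletion K)) 1) →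
            (padicValNat 2 (𝓕.selmerGroup.relIndex (SelmerStructure.selmerGroup (Function.update 𝓕 (Sum.inr v : Place K) ⊤))) : ℤ) =
              ℓ + e₃ (d % 2) ((d / (2 - d % 2)) % 8) :=
  hcounts_of_localTorsionCount_of_dualImageCount LocalLineCount.hLF1_holds hT4

end Assembly

end Summit.BirchSwinnertonDyer.BirchSwinnertonDyer.Theorems.PrintCf2.RestrictedSelmerPair

end
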